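import Summits.NavierStokesRegularity.NavierStokesRegularity.Theorems.CoreLogGasBlowupIsLocallyDrivenStretchingDepletion
import Summits.NavierStokesRegularity.NavierStokesRegularity.Theorems.CoreLogGasBlowupIsLocallyDrivenFarFieldReduction

/-!
# Crux `CoreLogGas.BlowupIsLocallyDriven` (stmt-NavierStokesRegularity-11291): depletion of the SHELL stretching, in
# the crux's vocabulary

`--supports stmt-NavierStokesRegularity-11291` (lead `prover-line-stmt-NavierStokesRegularity-11291-c5-0`, 2026-08-17).
Companion of `CoreLogGasBlowupIsLocallyDrivenStretchingDepletion.lean` (the far-field form for an abstract density `F`).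

The landed reductions of this crux (`Registered.blowupIsLocallyDriven_of_shellLocality`, `Rate.bRate_of_shellRate`,
p152530 / p158280) leave as load-bearing term the SHELL GRADIENT at a deep peak `x` with core radius `ρ`,

  `D_shell := ∇BS[1_{B(x,R)} ω](x) − ∇BS[1_{B(x,Mρ)} ω](x)`,  `ω = curl v`, `v = u(t)`,

with the Biot–Savart velocity written out over the in-tree `cross` exactly as in the route decl. This file proves, for a
smooth velocity field `v`, radii `0 < r₁ ≤ r₂` and a unit `e`:

* `fderiv_biotSavart_indicator_ball_sub` — `D_shell = ∇BS[1_{B(x,r₂) ∖ B(x,r₁)} ω](x)`: both truncated velocities are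
  differentiable at the centre (`differentiableAt_biotSavart_indicator_ball`: smooth-cutoff part by Tao's local law
  `Registered.centreGrad_differentiableAt_biotSavart`, annular remainder by the far-field lemma), and Biot–Savart is additive;
* `shellStretch_abs_le_depleted` (registered stub) — **depletion of the shell stretching**:
  `|⟪D_shell e, e⟫| ≤ A ∫_{B(x,r₂)∖B(x,r₁)} ‖ω(y) − ⟪ω(y),e⟫e‖ |x − y|⁻³ dy` — the shell strains the peak in the direction
  `e` only through the vorticity component ORTHOGONAL to `e` (Constantin–Fefferman);
* `shellStretch_eq_zero_of_parallel` — a shell vorticity everywhere parallel to `e` does not stretch along `e`;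
* `shellStretch_abs_le_rate` (registered stub) — **the `M⁻²` law**: if across the shell `B(x,R) ∖ B(x,Mρ)` the orthogonal
  component decays like `m ρ² |x − y|⁻²`, then `|⟪D_shell e, e⟫| ≤ C · m / M²` — the rate of the re-typed crux
  (`ShellRate2`, hypothesis of `Rate.bRate_of_shellRate`), from DIRECTION COHERENCE alone, slice by slice in time.

References: P. Constantin, C. Fefferman, Indiana Univ. Math. J. 42 (1993) 775–789, §2; T. Tao, arXiv:1108.1165 §10;
A. J. Majda, A. L. Bertozzi, *Vorticity and Incompressible Flow* (CUP 2002), §2.4.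
-/

noncomputable section

open Set MeasureTheory Filter Topology Metric
open scoped RealInnerProductSpace ContDiff

-- justification: the namespace is fixed by the crux protocol (sibling files of this crux use `…Theorems.BlowupIsLocallyDriven.*`).
set_option linter.dupNamespace false

namespace Summit.NavierStokesRegularity.NavierStokesRegularity.Theorems.BlowupIsLocallyDriven.Depletion

open Literature.Analysis.FluidPDE
open Summit.NavierStokesRegularity.NavierStokesRegularity.Theorems.BlowupIsLocallyDriven.Registered

/-! ### Truncated vorticities: measurability, integrability, bounds -/

/-- A vorticity `curl v` (`v ∈ C¹`) truncated to a measurable subset of a closed ball is integrable. [folklore] -/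
theorem integrable_indicator_curl {v : EuclideanSpace ℝ (Fin 3) → EuclideanSpace ℝ (Fin 3)} (hv : ContDiff ℝ 1 v)
    {S : Set (EuclideanSpace ℝ (Fin 3))} (hS : MeasurableSet S) {x : EuclideanSpace ℝ (Fin 3)} {R : ℝ}
    (hSR : S ⊆ closedBall x R) : Integrable (S.indicator (curl v)) :=
  (((continuous_curl hv).continuousOn.integrableOn_compact (isCompact_closedBall x R)).mono_set hSR).integrable_indicator
    hS

/-- A uniform bound of a truncated vorticity by a bound of `curl v` on an enclosing closed ball. [folklore] -/
theorem norm_indicator_curl_le {v : EuclideanSpace ℝ (Fin 3) → EuclideanSpace ℝ (Fin 3)}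
    {S : Set (EuclideanSpace ℝ (Fin 3))} {x : EuclideanSpace ℝ (Fin 3)} {R B : ℝ} (hSR : S ⊆ closedBall x R)
    (hB0 : 0 ≤ B) (hB : ∀ y ∈ closedBall x R, ‖curl v y‖ ≤ B) (y : EuclideanSpace ℝ (Fin 3)) :
    ‖S.indicator (curl v) y‖ ≤ B := by
  by_cases hy : y ∈ S
  · rw [indicator_of_mem hy]
    exact hB y (hSR hy)
  · rw [indicator_of_notMem hy, norm_zero]
    exact hB0

/-- **Additivity of the truncated Biot–Savart velocities**: for `0 < r₁ ≤ r₂`,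
`BS[1_{B(x,r₂)} ω] = BS[1_{B(x,r₁)} ω] + BS[1_{B(x,r₂) ∖ B(x,r₁)} ω]` everywhere (`ω = curl v`, each kernel integrand
integrable). [folklore] -/
theorem biotSavart_indicator_ball_eq_add {v : EuclideanSpace ℝ (Fin 3) → EuclideanSpace ℝ (Fin 3)}
    (hv : ContDiff ℝ 1 v) (x : EuclideanSpace ℝ (Fin 3)) {r₁ r₂ : ℝ} (h₁ : 0 < r₁) (h₁₂ : r₁ ≤ r₂) :
    biotSavart ((ball x r₂).indicator (curl v)) =
      biotSavart ((ball x r₁).indicator (curl v)) + biotSavart ((ball x r₂ \ ball x r₁).indicator (curl v)) := by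
  have h₂ : 0 < r₂ := h₁.trans_le h₁₂
  -- the pointwise identity of the truncations
  have hind : ∀ y, (ball x r₂).indicator (curl v) y =
      (ball x r₁).indicator (curl v) y + (ball x r₂ \ ball x r₁).indicator (curl v) y := by
    intro y
    by_cases hy₁ : y ∈ ball x r₁
    · have hy₂ : y ∈ ball x r₂ := ball_subset_ball h₁₂ hy₁
      have hy₃ : y ∉ ball x r₂ \ ball x r₁ := fun h => h.2 hy₁
      rw [indicator_of_mem hy₂, indicator_of_mem hy₁, indicator_of_notMem hy₃, add_zero]
    · by_cases hy₂ : y ∈ ball x r₂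
      · have hy₃ : y ∈ ball x r₂ \ ball x r₁ := ⟨hy₂, hy₁⟩
        rw [indicator_of_mem hy₂, indicator_of_notMem hy₁, indicator_of_mem hy₃, zero_add]
      · have hy₃ : y ∉ ball x r₂ \ ball x r₁ := fun h => hy₂ h.1
        rw [indicator_of_notMem hy₂, indicator_of_notMem hy₁, indicator_of_notMem hy₃, add_zero]
  -- a common bound on the closed ball of radius r₂
  obtain ⟨B, hB⟩ := (isCompact_closedBall x r₂).exists_bound_of_continuousOn (continuous_curl hv).continuousOn
  have hB0 : 0 ≤ B := (norm_nonneg _).trans (hB x (mem_closedBall_self h₂.le))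
  have hS₁ : ball x r₁ ⊆ closedBall x r₂ := (ball_subset_ball h₁₂).trans ball_subset_closedBall
  have hS₃ : ball x r₂ \ ball x r₁ ⊆ closedBall x r₂ := Set.sdiff_subset.trans ball_subset_closedBall
  have hm : Measurable (curl v) := measurable_curl v
  funext z
  simp only [Pi.add_apply, biotSavart]
  rw [← integral_add
    (integrable_biotSavartKernel_sub_apply (hm.indicator measurableSet_ball)
      (integrable_indicator_curl hv measurableSet_ball hS₁) (norm_indicator_curl_le hS₁ hB0 hB) z)
    (integrable_biotSavartKernel_sub_apply (hm.indicator (measurableSet_ball.diff measurableSet_ball))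
      (integrable_indicator_curl hv (measurableSet_ball.diff measurableSet_ball) hS₃)
      (norm_indicator_curl_le hS₃ hB0 hB) z)]
  refine integral_congr_ae (Eventually.of_forall fun y => ?_)
  beta_reduce
  rw [hind y, ← biotSavartCLM_apply, ← biotSavartCLM_apply, ← biotSavartCLM_apply, map_add]

/-- **The velocity of a sharply truncated vorticity is differentiable at the centre.** For smooth `v` and `S > 0`,
`BS[1_{B(x,S)} curl v]` is differentiable at `x`: with `r = S/3` and the smooth cutoff `ψ = ballCutoff x r` (`= 1` on
`B̄(x,2r)`, supported in `B(x,3r) = B(x,S)`), `1_{B(x,S)} ω = ψω + F` with `F` integrable and vanishing on `B(x,2r)`;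
`BS[ψω]` is differentiable everywhere (Tao's local Biot–Savart law, `Registered.centreGrad_differentiableAt_biotSavart`)
and `BS[F]` at `x` (`differentiableAt_biotSavart_farField`). [folklore] -/
theorem differentiableAt_biotSavart_indicator_ball {v : EuclideanSpace ℝ (Fin 3) → EuclideanSpace ℝ (Fin 3)}
    (hv : ContDiff ℝ ∞ v) (x : EuclideanSpace ℝ (Fin 3)) {S : ℝ} (hS : 0 < S) :
    DifferentiableAt ℝ (biotSavart ((ball x S).indicator (curl v))) x := by
  obtain ⟨r, hr_def⟩ : ∃ r : ℝ, r = S / 3 := ⟨_, rfl⟩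
  have hr : 0 < r := by rw [hr_def]; positivity
  have h3r : 3 * r = S := by rw [hr_def]; ring
  have hv1 : ContDiff ℝ 1 v := hv.of_le (by exact_mod_cast le_top)
  have hwc : Continuous (curl v) := continuous_curl hv1
  have hwm : Measurable (curl v) := measurable_curl v
  have hψc : Continuous (ballCutoff x r) := (contDiff_ballCutoff x r (n := 0)).continuous
  have hψs : HasCompactSupport (ballCutoff x r) := hasCompactSupport_ballCutoff hr
  have hψ0 : ∀ y, y ∉ ball x S → ballCutoff x r y = 0 := by
    intro y hy
    rw [mem_ball, dist_eq_norm, not_lt, ← h3r] at hy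
    exact ballCutoff_eq_zero hr hy
  obtain ⟨B, hB⟩ := (isCompact_closedBall x S).exists_bound_of_continuousOn hwc.continuousOn
  have hB0 : 0 ≤ B := (norm_nonneg _).trans (hB x (mem_closedBall_self hS.le))
  -- the localised vorticity `G = ψ • curl v`
  obtain ⟨G, hG_def⟩ : ∃ G : EuclideanSpace ℝ (Fin 3) → EuclideanSpace ℝ (Fin 3),
      G = fun y => ballCutoff x r y • curl v y := ⟨_, rfl⟩
  have hGc : Continuous G := by rw [hG_def]; exact hψc.smul hwc
  have hGs : HasCompactSupport G := by rw [hG_def]; exact hψs.smul_right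
  have hGi : Integrable G := hGc.integrable_of_hasCompactSupport hGs
  have hGm : Measurable G := hGc.measurable
  have hGb : ∀ y, ‖G y‖ ≤ B := by
    intro y
    rw [hG_def]
    by_cases hy : y ∈ ball x S
    · calc ‖ballCutoff x r y • curl v y‖ = |ballCutoff x r y| * ‖curl v y‖ := norm_smul _ _
        _ ≤ 1 * ‖curl v y‖ := mul_le_mul_of_nonneg_right (abs_ballCutoff_le_one x r y) (norm_nonneg _)
        _ ≤ B := by rw [one_mul]; exact hB y (ball_subset_closedBall hy)
    · simp [hψ0 y hy, hB0]
  -- the annular remainder `F = (1_{B(x,S)} − ψ) curl v`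
  obtain ⟨F, hF_def⟩ : ∃ F : EuclideanSpace ℝ (Fin 3) → EuclideanSpace ℝ (Fin 3),
      F = fun y => (ball x S).indicator (curl v) y - G y := ⟨_, rfl⟩
  have hIi : Integrable ((ball x S).indicator (curl v)) :=
    integrable_indicator_curl hv1 measurableSet_ball ball_subset_closedBall
  have hFi : Integrable F := by rw [hF_def]; exact hIi.sub hGi
  have hFm : Measurable F := by rw [hF_def]; exact (hwm.indicator measurableSet_ball).sub hGm
  have hFb : ∀ y, ‖F y‖ ≤ B + B := by
    intro y
    rw [hF_def]
    exact (norm_sub_le _ _).trans (add_le_add (norm_indicator_curl_le ball_subset_closedBall hB0 hB y) (hGb y))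
  have hF0 : ∀ y ∈ ball x (2 * r), F y = 0 := by
    intro y hy
    have hyS : y ∈ ball x S := by
      refine ball_subset_ball ?_ hy
      rw [← h3r]; linarith
    have hψ1 : ballCutoff x r y = 1 := by
      rw [mem_ball, dist_eq_norm] at hy
      exact ballCutoff_eq_one hr hy.le
    rw [hF_def, hG_def]
    simp [indicator_of_mem hyS, hψ1]
  -- the decomposition `BS[1_{B(x,S)} curl v] = BS[G] + BS[F]` (everywhere)
  have hsplit : biotSavart ((ball x S).indicator (curl v)) = biotSavart G + biotSavart F := by
    funext z
    simp only [Pi.add_apply, biotSavart]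
    rw [← integral_add (integrable_biotSavartKernel_sub_apply hGm hGi hGb z)
      (integrable_biotSavartKernel_sub_apply hFm hFi hFb z)]
    refine integral_congr_ae (Eventually.of_forall fun y => ?_)
    have hGF : (ball x S).indicator (curl v) y = G y + F y := by
      simp only [hF_def]; abel
    beta_reduce
    rw [hGF, ← biotSavartCLM_apply, ← biotSavartCLM_apply, ← biotSavartCLM_apply, map_add]
  have hdG : DifferentiableAt ℝ (biotSavart G) x := by
    rw [hG_def]
    exact centreGrad_differentiableAt_biotSavart hv hr x x
  rw [hsplit]
  exact hdG.add (differentiableAt_biotSavart_farField hFi (by positivity : 0 < 2 * r) hF0)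

/-- The shell vorticity `1_{B(x,r₂) ∖ B(x,r₁)} ω` vanishes on the inner ball. [folklore] -/
theorem indicator_shell_eq_zero_of_mem_ball (w : EuclideanSpace ℝ (Fin 3) → EuclideanSpace ℝ (Fin 3))
    (x : EuclideanSpace ℝ (Fin 3)) (r₁ r₂ : ℝ) (y : EuclideanSpace ℝ (Fin 3)) (hy : y ∈ ball x r₁) :
    (ball x r₂ \ ball x r₁).indicator w y = 0 :=
  indicator_of_notMem (fun h => h.2 hy) _

/-- **The shell gradient is the gradient of the shell's own Biot–Savart velocity**: for smooth `v`, `0 < r₁ ≤ r₂`,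
`∇BS[1_{B(x,r₂)} ω](x) − ∇BS[1_{B(x,r₁)} ω](x) = ∇BS[1_{B(x,r₂) ∖ B(x,r₁)} ω](x)`. [folklore] -/
theorem fderiv_biotSavart_indicator_ball_sub {v : EuclideanSpace ℝ (Fin 3) → EuclideanSpace ℝ (Fin 3)}
    (hv : ContDiff ℝ ∞ v) (x : EuclideanSpace ℝ (Fin 3)) {r₁ r₂ : ℝ} (h₁ : 0 < r₁) (h₁₂ : r₁ ≤ r₂) :
    fderiv ℝ (biotSavart ((ball x r₂).indicator (curl v))) x - fderiv ℝ (biotSavart ((ball x r₁).indicator (curl v))) x =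
      fderiv ℝ (biotSavart ((ball x r₂ \ ball x r₁).indicator (curl v))) x := by
  have hv1 : ContDiff ℝ 1 v := hv.of_le (by exact_mod_cast le_top)
  have hFi : Integrable ((ball x r₂ \ ball x r₁).indicator (curl v)) :=
    integrable_indicator_curl hv1 (measurableSet_ball.diff measurableSet_ball) (Set.sdiff_subset.trans ball_subset_closedBall)
  rw [biotSavart_indicator_ball_eq_add hv1 x h₁ h₁₂,
    fderiv_add (differentiableAt_biotSavart_indicator_ball hv x h₁)
      (differentiableAt_biotSavart_farField hFi h₁ (indicator_shell_eq_zero_of_mem_ball (curl v) x r₁ r₂)),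
    add_sub_cancel_left]

/-! ### Depletion of the shell stretching, in the crux's vocabulary -/

/-- The depleted integrand of the shell vorticity is the shell-restriction of the depleted integrand of `ω`. [folklore] -/
theorem depleted_indicator_shell (w : EuclideanSpace ℝ (Fin 3) → EuclideanSpace ℝ (Fin 3))
    (x : EuclideanSpace ℝ (Fin 3)) (r₁ r₂ : ℝ) (e : EuclideanSpace ℝ (Fin 3)) (y : EuclideanSpace ℝ (Fin 3)) :
    ‖(ball x r₂ \ ball x r₁).indicator w y - ⟪(ball x r₂ \ ball x r₁).indicator w y, e⟫ • e‖ * (‖x - y‖ ^ 3)⁻¹ =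
      (ball x r₂ \ ball x r₁).indicator (fun y => ‖w y - ⟪w y, e⟫ • e‖ * (‖x - y‖ ^ 3)⁻¹) y := by
  by_cases hy : y ∈ ball x r₂ \ ball x r₁
  · rw [indicator_of_mem hy, indicator_of_mem hy]
  · rw [indicator_of_notMem hy, indicator_of_notMem hy]
    simp

/-- **Depletion of the shell stretching (registered stub `shellStretch_abs_le_depleted`).** There is an absolute `A ≥ 0`
such that for every smooth `v`, centre `x`, radii `0 < r₁ ≤ r₂` and unit `e`, the shell gradient of the crux — the
difference of the gradients at `x` of the written-out Biot–Savart velocities of `1_{B(x,r₂)} curl v` and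
`1_{B(x,r₁)} curl v` — satisfies `|⟪D_shell e, e⟫| ≤ A ∫_{B(x,r₂) ∖ B(x,r₁)} ‖ω(y) − ⟪ω(y),e⟫e‖ |x − y|⁻³ dy`,
`ω = curl v`: the shell strains the peak along `e` only through the vorticity component ORTHOGONAL to `e`
(`‖ω − ⟪ω,e⟫e‖ = |ω| |sin ∠(ω, e)|`). [cite: ConstantinFeffermanIndiana1993, §2 (the kernel estimate with the factor |sin φ|)] -/
theorem shellStretch_abs_le_depleted : ∃ A : ℝ, 0 ≤ A ∧ ∀ (v : EuclideanSpace ℝ (Fin 3) → EuclideanSpace ℝ (Fin 3)) (x : EuclideanSpace ℝ (Fin 3)) (r₁ r₂ : ℝ) (e : EuclideanSpace ℝ (Fin 3)), ContDiff ℝ ∞ v → 0 < r₁ → r₁ ≤ r₂ → ‖e‖ = 1 → |inner ℝ ((fderiv ℝ (fun z : EuclideanSpace ℝ (Fin 3) => ∫ y, (4 * Real.pi * ‖z - y‖ ^ 3)⁻¹ • Literature.Analysis.FluidPDE.cross ((Metric.ball x r₂).indicator (Literature.Analysis.FluidPDE.curl v) y) (z - y)) x - fderiv ℝ (fun z : EuclideanSpace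 ℝ (Fin 3) => ∫ y, (4 * Real.pi * ‖z - y‖ ^ 3)⁻¹ • Literature.Analysis.FluidPDE.cross ((Metric.ball x r₁).indicator (Literature.Analysis.FluidPDE.curl v) y) (z - y)) x) e) e| ≤ A * ∫ y in Metric.ball x r₂ \ Metric.ball x r₁, ‖Literature.Analysis.FluidPDE.curl v y - inner ℝ (Literature.Analysis.FluidPDE.curl v y) e • e‖ * (‖x - y‖ ^ 3)⁻¹ := by
  obtain ⟨A, hK⟩ := exists_isC1SingularKernel_biotSavartCLM
  refine ⟨A, hK.nonneg, fun v x r₁ r₂ e hv h₁ h₁₂ he => ?_⟩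
  have hv1 : ContDiff ℝ 1 v := hv.of_le (by exact_mod_cast le_top)
  have hFi : Integrable ((ball x r₂ \ ball x r₁).indicator (curl v)) :=
    integrable_indicator_curl hv1 (measurableSet_ball.diff measurableSet_ball) (Set.sdiff_subset.trans ball_subset_closedBall)
  rw [farField_inlined_eq_biotSavart, farField_inlined_eq_biotSavart, fderiv_biotSavart_indicator_ball_sub hv x h₁ h₁₂,
    ← integral_indicator (measurableSet_ball.diff measurableSet_ball)]
  refine (abs_inner_fderiv_biotSavart_farField_le_integral hK hFi h₁
    (indicator_shell_eq_zero_of_mem_ball (curl v) x r₁ r₂) he).trans (le_of_eq ?_)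
  congr 1
  exact integral_congr_ae (Eventually.of_forall fun y => depleted_indicator_shell (curl v) x r₁ r₂ e y)

/-- **Parallel shell vorticity does not stretch.** If on the shell `B(x,r₂) ∖ B(x,r₁)` the vorticity is everywhere
parallel to `e` (`curl v y = c(y) e`), the shell gradient has `⟪D_shell e, e⟫ = 0`: straight tubes, antiparallel pairs
and unidirectional layers crossing the shell exert only transverse strain and rotation at the peak (Constantin's
identity). [cite: LemarieRieusset2016, Thm. 11.7 (proof, PDF p. 370)] -/
theorem shellStretch_eq_zero_of_parallel {v : EuclideanSpace ℝ (Fin 3) → EuclideanSpace ℝ (Fin 3)}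
    (hv : ContDiff ℝ ∞ v) (x : EuclideanSpace ℝ (Fin 3)) {r₁ r₂ : ℝ} (h₁ : 0 < r₁) (h₁₂ : r₁ ≤ r₂)
    (e : EuclideanSpace ℝ (Fin 3)) (c : EuclideanSpace ℝ (Fin 3) → ℝ)
    (hpar : ∀ y ∈ ball x r₂ \ ball x r₁, curl v y = c y • e) :
    inner ℝ ((fderiv ℝ (fun z : EuclideanSpace ℝ (Fin 3) => ∫ y, (4 * Real.pi * ‖z - y‖ ^ 3)⁻¹ • Literature.Analysis.FluidPDE.cross ((Metric.ball x r₂).indicator (Literature.Analysis.FluidPDE.curl v) y) (z - y)) x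
      - fderiv ℝ (fun z : EuclideanSpace ℝ (Fin 3) => ∫ y, (4 * Real.pi * ‖z - y‖ ^ 3)⁻¹ • Literature.Analysis.FluidPDE.cross ((Metric.ball x r₁).indicator (Literature.Analysis.FluidPDE.curl v) y) (z - y)) x) e) e = 0 := by
  have hv1 : ContDiff ℝ 1 v := hv.of_le (by exact_mod_cast le_top)
  have hFi : Integrable ((ball x r₂ \ ball x r₁).indicator (curl v)) :=
    integrable_indicator_curl hv1 (measurableSet_ball.diff measurableSet_ball) (Set.sdiff_subset.trans ball_subset_closedBall)
  rw [farField_inlined_eq_biotSavart, farField_inlined_eq_biotSavart, fderiv_biotSavart_indicator_ball_sub hv x h₁ h₁₂]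
  refine inner_fderiv_biotSavart_farField_eq_zero_of_parallel hFi h₁
    (indicator_shell_eq_zero_of_mem_ball (curl v) x r₁ r₂) e ((ball x r₂ \ ball x r₁).indicator c) (fun y => ?_)
  by_cases hy : y ∈ ball x r₂ \ ball x r₁
  · rw [indicator_of_mem hy, indicator_of_mem hy, hpar y hy]
  · rw [indicator_of_notMem hy, indicator_of_notMem hy, zero_smul]

/-- **The `M⁻²` law for the shell (registered stub `shellStretch_abs_le_rate`).** There is an absolute `C ≥ 0` such that
for every smooth `v`, centre `x`, `ρ, M > 0` with `Mρ ≤ R`, unit `e` and `m ≥ 0`: if across the shell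
`B(x,R) ∖ B(x,Mρ)` the component of `ω = curl v` orthogonal to `e` decays quadratically in core units,
`‖ω(y) − ⟪ω(y),e⟫e‖ ≤ m ρ² |x − y|⁻²`, then the shell gradient of the crux obeys `|⟪D_shell e, e⟫| ≤ C · m / M²` — the
rate-form shell locality (`ShellRate2`, hypothesis of `Rate.bRate_of_shellRate`) at this `(x, ρ, M, e)`, obtained from
direction coherence with no time integration. [folklore] -/
theorem shellStretch_abs_le_rate : ∃ C : ℝ, 0 ≤ C ∧ ∀ (v : EuclideanSpace ℝ (Fin 3) → EuclideanSpace ℝ (Fin 3)) (x : EuclideanSpace ℝ (Fin 3)) (ρ M R : ℝ) (e : EuclideanSpace ℝ (Fin 3)) (m : ℝ), ContDiff ℝ ∞ v → 0 < ρ → 0 < M → M * ρ ≤ R → ‖e‖ = 1 → 0 ≤ m → (∀ y ∈ Metric.ball x R \ Metric.ball x (M * ρ), ‖Literature.Analysis.FluidPDE.curl v y - inner ℝ (Literature.Analysis.FluidPDE.curl v y) e • e‖ ≤ m * ρ ^ 2 * (‖x - y‖ ^ 2)⁻¹) → |inner ℝ ((fderiv ℝ (fun z : EuclideanSpace ℝ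 (Fin 3) => ∫ y, (4 * Real.pi * ‖z - y‖ ^ 3)⁻¹ • Literature.Analysis.FluidPDE.cross ((Metric.ball x R).indicator (Literature.Analysis.FluidPDE.curl v) y) (z - y)) x - fderiv ℝ (fun z : EuclideanSpace ℝ (Fin 3) => ∫ y, (4 * Real.pi * ‖z - y‖ ^ 3)⁻¹ • Literature.Analysis.FluidPDE.cross ((Metric.ball x (M * ρ)).indicator (Literature.Analysis.FluidPDE.curl v) y) (z - y)) x) e) e| ≤ C * m / M ^ 2 := by
  obtain ⟨A, hK⟩ := exists_isC1SingularKernel_biotSavartCLM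
  refine ⟨3 / 2 * (volume : Measure (EuclideanSpace ℝ (Fin 3))).real (ball 0 1) * A, ?_, ?_⟩
  · have := hK.nonneg
    positivity
  intro v x ρ M R e m hv hρ hM hMR he hm hdec
  have hv1 : ContDiff ℝ 1 v := hv.of_le (by exact_mod_cast le_top)
  have h₁ : 0 < M * ρ := mul_pos hM hρ
  have hFi : Integrable ((ball x R \ ball x (M * ρ)).indicator (curl v)) :=
    integrable_indicator_curl hv1 (measurableSet_ball.diff measurableSet_ball) (Set.sdiff_subset.trans ball_subset_closedBall)
  rw [farField_inlined_eq_biotSavart, farField_inlined_eq_biotSavart, fderiv_biotSavart_indicator_ball_sub hv x h₁ hMR]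
  refine abs_inner_fderiv_biotSavart_farField_le_rate hK hFi hρ hM
    (indicator_shell_eq_zero_of_mem_ball (curl v) x (M * ρ) R) he (fun y hy => ?_)
  by_cases hy' : y ∈ ball x R \ ball x (M * ρ)
  · rw [indicator_of_mem hy']
    exact hdec y hy'
  · rw [indicator_of_notMem hy', inner_zero_left, zero_smul, sub_zero, norm_zero]
    positivity

end Summit.NavierStokesRegularity.NavierStokesRegularity.Theorems.BlowupIsLocallyDriven.Depletion
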